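import Summits.Parity.BatemanHorn.Theorems.SoloInformedPartialSummationPow
import Summits.Parity.BatemanHorn.Theorems.SoloInformedPolynomialPrimeCount

/-!
# SoloInformedSystemPrimeCount — the `π`-level of the localisation for EVERY Bateman–Horn system

Solo unit `solo-Parity-informed` (ideation tier, informed mode), session 16; `PLAN.md` §24.1, CLAIMS C68.

`SoloInformedPolynomialPrimeCount` did this for one polynomial.  Here `f : ι → ℤ[X]` is an arbitrary finite family
with `IsBatemanHornSystem f` (`k = card ι` polynomials, irreducible, positive leading coefficients, pairwise
non-associated, no fixed prime divisor); `C(f) = batemanHornConst f > 0` and the convergence of the product are PROVED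
in the tree (`IsBatemanHornSystem.hasBatemanHornConst_holds`), `D = ∏ᵢ deg fᵢ`.  Write

  `π_f(x) = polyPrimeCount f x = #{0 ≤ n ≤ x : every fᵢ(n) > 0 and prime}`   (the conjunct's counting function),
  `P_f(x) = #{1 ≤ n ≤ x : every |fᵢ(n)| prime}`,
  `Θ_f(x) = ∑_{1 ≤ n ≤ x, every |fᵢ(n)| prime} ∏ᵢ log |fᵢ(n)|`.

Results, unconditional, for every system:

* `batemanHornAsymptotic_iff_isEquivalent_card_system` — `BatemanHornAsymptotic f ⟺ P_f(x) ~ (C(f)/D) · x / log^k x`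
  (`|π_f - P_f| = O(1)`: all values are positive from some point on);
* `batemanHornAsymptotic_iff_isEquivalent_theta_system` — `BatemanHornAsymptotic f ⟺ Θ_f(x) ~ C(f) x` (`k ≥ 1`):
  the partial summation of `SoloInformedPartialSummationPow` with the weights `∏ᵢ log |fᵢ(n)| ~ D log^k n`
  (`isEquivalent_prod_log_natAbs_eval`, from `log |g(n)| = deg g · log n + O(1)` factor by factor);
* the `Fin k` forms `…_fin` matching the conjunct `BatemanHorn = ∀ k f, IsBatemanHornSystem f → BatemanHornAsymptotic f`.

So the WHOLE conjunct is, system by system, the statement `Θ_f(x) ~ C(f) x`.  No bearing on its truth.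
-/

namespace Summit.Parity.BatemanHorn.Theorems

open Finset Filter Asymptotics Polynomial
open scoped Topology
open Literature.NumberTheory.Sieve (polyPrimeCount IsBatemanHornSystem batemanHornConst HasBatemanHornConst
  BatemanHornAsymptotic)

variable {ι : Type*} [Fintype ι]

/-! ### `polyPrimeCount f` versus `#{1 ≤ n ≤ x : every |fᵢ(n)| prime}` -/

/-- `π_f(x) ≤ P_f(x) + 1` (the `+1` accounts for `n = 0`). -/
theorem polyPrimeCount_le_card_allPrime_add_one (f : ι → ℤ[X]) (x : ℕ) :
    polyPrimeCount f x
      ≤ #((Icc 1 x).filter fun n : ℕ => ∀ i, Nat.Prime ((f i).eval (n : ℤ)).natAbs) + 1 := by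
  classical
  unfold polyPrimeCount
  refine (card_le_card fun n hn => ?_).trans (card_insert_le 0 _)
  rw [mem_filter, mem_range] at hn
  obtain ⟨hnx, hall⟩ := hn
  rw [mem_insert]
  rcases Nat.eq_zero_or_pos n with h0 | h0
  · exact Or.inl h0
  · refine Or.inr (mem_filter.mpr ⟨mem_Icc.mpr ⟨h0, by omega⟩, fun i => ?_⟩)
    obtain ⟨hpos, hprime⟩ := hall i
    have h : ((f i).eval (n : ℤ)).toNat = ((f i).eval (n : ℤ)).natAbs := by omega
    rwa [h] at hprime

/-- `P_f(x) ≤ π_f(x) + n₀` once every `fᵢ(n) > 0` for `n ≥ n₀`. -/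
theorem card_allPrime_le_polyPrimeCount_add (f : ι → ℤ[X]) {n₀ : ℕ}
    (hpos : ∀ i, ∀ n : ℕ, n₀ ≤ n → 0 < (f i).eval (n : ℤ)) (x : ℕ) :
    #((Icc 1 x).filter fun n : ℕ => ∀ i, Nat.Prime ((f i).eval (n : ℤ)).natAbs)
      ≤ polyPrimeCount f x + n₀ := by
  classical
  unfold polyPrimeCount
  rw [← card_range n₀]
  refine (card_le_card fun n hn => ?_).trans (card_union_le _ _)
  rw [mem_filter, mem_Icc] at hn
  obtain ⟨⟨hn1, hnx⟩, hprime⟩ := hn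
  rw [mem_union, mem_filter, mem_range, mem_range]
  rcases Nat.lt_or_ge n n₀ with h | h
  · exact Or.inr h
  · refine Or.inl ⟨by omega, fun i => ⟨hpos i n h, ?_⟩⟩
    have h' : ((f i).eval (n : ℤ)).toNat = ((f i).eval (n : ℤ)).natAbs := by
      have := hpos i n h
      omega
    rw [h']
    exact hprime i

/-- All values of a Bateman–Horn system are positive from some point on (positive leading coefficients). -/
theorem exists_forall_eval_pos_of_isBatemanHornSystem {f : ι → ℤ[X]} (hf : IsBatemanHornSystem f) :
    ∃ n₀ : ℕ, ∀ i, ∀ n : ℕ, n₀ ≤ n → 0 < (f i).eval (n : ℤ) := by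
  choose n₀ hn₀ using fun i => exists_eval_natCast_pos (hf.natDegree_pos i) (hf.leadingCoeff_pos i)
  exact ⟨univ.sup n₀, fun i n hn => hn₀ i n ((Finset.le_sup (mem_univ i)).trans hn)⟩

/-! ### Real-analysis helpers -/

/-- `K x / log^k x → ∞` along `ℕ` for `K > 0`. -/
theorem tendsto_const_mul_div_log_pow_atTop {K : ℝ} (hK : 0 < K) (k : ℕ) :
    Tendsto (fun x : ℕ => K * (x : ℝ) / Real.log x ^ k) atTop atTop := by
  have e : ∀ᶠ t : ℝ in atTop, ‖Real.log t ^ (k : ℝ)‖ ≤ 1 * ‖t ^ (1 / 2 : ℝ)‖ :=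
    (isLittleO_log_rpow_rpow_atTop (k : ℝ) (by norm_num : (0 : ℝ) < 1 / 2)).bound one_pos
  have hT : Tendsto (fun x : ℕ => K * (x : ℝ) ^ (1 / 2 : ℝ)) atTop atTop :=
    ((tendsto_rpow_atTop (by norm_num)).comp tendsto_natCast_atTop_atTop).const_mul_atTop hK
  refine tendsto_atTop_mono' atTop ?_ hT
  filter_upwards [tendsto_natCast_atTop_atTop.eventually e, eventually_ge_atTop 3] with x hx hx3
  have hX : (3 : ℝ) ≤ x := by exact_mod_cast hx3
  have hX0 : (0 : ℝ) < x := by linarith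
  have hlog : 0 < Real.log x := Real.log_pos (by linarith)
  rw [Real.rpow_natCast, one_mul, Real.norm_eq_abs, Real.norm_eq_abs, abs_of_pos (pow_pos hlog _),
    abs_of_pos (Real.rpow_pos_of_pos hX0 _)] at hx
  rw [le_div_iff₀ (pow_pos hlog _)]
  calc K * (x : ℝ) ^ (1 / 2 : ℝ) * Real.log x ^ k ≤ K * (x : ℝ) ^ (1 / 2 : ℝ) * (x : ℝ) ^ (1 / 2 : ℝ) :=
        mul_le_mul_of_nonneg_left hx (by positivity)
    _ = K * x := by
        rw [mul_assoc, ← Real.rpow_add hX0, show (1 / 2 : ℝ) + 1 / 2 = 1 by norm_num, Real.rpow_one]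

/-- Two real sequences at eventually bounded distance, one of them tending to `+∞`, are asymptotic. -/
theorem isEquivalent_of_eventually_abs_sub_le {u v : ℕ → ℝ} {K : ℝ}
    (hK : ∀ᶠ x : ℕ in atTop, |u x - v x| ≤ K) (hv : Tendsto v atTop atTop) : u ~[atTop] v := by
  rw [IsEquivalent, isLittleO_iff]
  intro c hc
  filter_upwards [hK, hv.eventually_ge_atTop (K / c), hv.eventually_ge_atTop 0] with x hx hKc hv0
  rw [Pi.sub_apply, Real.norm_eq_abs, Real.norm_eq_abs, abs_of_nonneg hv0]
  have : K ≤ c * v x := by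
    have := (div_le_iff₀ hc).mp hKc
    linarith
  linarith

/-- **The weights of a system: `∏ᵢ log |fᵢ(n)| ~ (∏ᵢ deg fᵢ) · log^k n`** (`k = card ι`, all degrees `≥ 1`). -/
theorem isEquivalent_prod_log_natAbs_eval {f : ι → ℤ[X]} (hdeg : ∀ i, 0 < (f i).natDegree) :
    (fun n : ℕ => ∏ i, Real.log ((((f i).eval (n : ℤ)).natAbs : ℕ) : ℝ)) ~[atTop]
      fun n : ℕ => (∏ i, ((f i).natDegree : ℝ)) * Real.log n ^ Fintype.card ι := by
  have h1 : ∀ i ∈ (univ : Finset ι),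
      (fun n : ℕ => Real.log ((((f i).eval (n : ℤ)).natAbs : ℕ) : ℝ)) ~[atTop]
        fun n : ℕ => ((f i).natDegree : ℝ) * Real.log n := by
    intro i _
    obtain ⟨B, hB⟩ := exists_abs_log_natAbs_eval_sub_le (hdeg i)
    refine isEquivalent_of_eventually_abs_sub_le (K := B) ?_ ?_
    · filter_upwards [eventually_ge_atTop 1] with n hn using hB n hn
    · exact (Real.tendsto_log_atTop.comp tendsto_natCast_atTop_atTop).const_mul_atTop
        (Nat.cast_pos.mpr (hdeg i))
  refine (IsEquivalent.finsetProd h1).congr_right (Eventually.of_forall fun n => ?_)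
  simp only [prod_mul_distrib, prod_const, card_univ]

/-! ### The `π`-level ⟺ the count ⟺ the `Θ`-level, for every system -/

/-- **`BatemanHornAsymptotic f ⟺ #{1 ≤ n ≤ x : every |fᵢ(n)| prime} ~ (C(f)/∏ deg fᵢ) · x / log^k x`**
for every Bateman–Horn system `f : ι → ℤ[X]` (`k = card ι`). -/
theorem batemanHornAsymptotic_iff_isEquivalent_card_system {f : ι → ℤ[X]} (hf : IsBatemanHornSystem f) :
    BatemanHornAsymptotic f ↔
      (fun x : ℕ => (#((Icc 1 x).filter fun n : ℕ => ∀ i, Nat.Prime ((f i).eval (n : ℤ)).natAbs) : ℝ))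
        ~[atTop] fun x : ℕ =>
          batemanHornConst f / (∏ i, ((f i).natDegree : ℝ)) * (x : ℝ) / Real.log x ^ Fintype.card ι := by
  obtain ⟨hconst, hCpos⟩ := IsBatemanHornSystem.hasBatemanHornConst_holds hf
  obtain ⟨n₀, hn₀⟩ := exists_forall_eval_pos_of_isBatemanHornSystem hf
  have hD : (0 : ℝ) < ∏ i, ((f i).natDegree : ℝ) :=
    prod_pos fun i _ => Nat.cast_pos.mpr (hf.natDegree_pos i)
  have hmain : Tendsto (fun x : ℕ =>
      batemanHornConst f / (∏ i, ((f i).natDegree : ℝ)) * (x : ℝ) / Real.log x ^ Fintype.card ι)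
        atTop atTop :=
    tendsto_const_mul_div_log_pow_atTop (by positivity) _
  have hdiff : ∀ x : ℕ,
      |(#((Icc 1 x).filter fun n : ℕ => ∀ i, Nat.Prime ((f i).eval (n : ℤ)).natAbs) : ℝ)
          - (polyPrimeCount f x : ℝ)| ≤ n₀ + 1 := by
    intro x
    have h1 : (polyPrimeCount f x : ℝ)
        ≤ (#((Icc 1 x).filter fun n : ℕ => ∀ i, Nat.Prime ((f i).eval (n : ℤ)).natAbs) : ℝ) + 1 := by
      exact_mod_cast polyPrimeCount_le_card_allPrime_add_one f x
    have h2 : (#((Icc 1 x).filter fun n : ℕ => ∀ i, Nat.Prime ((f i).eval (n : ℤ)).natAbs) : ℝ)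
        ≤ (polyPrimeCount f x : ℝ) + n₀ := by
      exact_mod_cast card_allPrime_le_polyPrimeCount_add f hn₀ x
    rw [abs_le]
    constructor <;> linarith
  have hdiff' : ∀ x : ℕ,
      |(polyPrimeCount f x : ℝ)
          - (#((Icc 1 x).filter fun n : ℕ => ∀ i, Nat.Prime ((f i).eval (n : ℤ)).natAbs) : ℝ)|
        ≤ n₀ + 1 := fun x => by
    rw [abs_sub_comm]
    exact hdiff x
  unfold BatemanHornAsymptotic
  constructor
  · rintro ⟨C, hC, hπ⟩
    have hCeq : C = batemanHornConst f := tendsto_nhds_unique hC hconst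
    rw [hCeq] at hπ
    exact isEquivalent_of_abs_sub_le hdiff hmain hπ
  · intro h
    exact ⟨_, hconst, isEquivalent_of_abs_sub_le hdiff' hmain h⟩

/-- **`BatemanHornAsymptotic f ⟺ Θ_f(x) ~ C(f) x`** for every Bateman–Horn system of `k ≥ 1` polynomials:
the partial summation with the weights `∏ᵢ log |fᵢ(n)| ~ (∏ᵢ deg fᵢ) log^k n`. -/
theorem batemanHornAsymptotic_iff_isEquivalent_theta_system [Nonempty ι] {f : ι → ℤ[X]}
    (hf : IsBatemanHornSystem f) :
    BatemanHornAsymptotic f ↔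
      (fun x : ℕ => ∑ n ∈ (Icc 1 x).filter (fun n : ℕ => ∀ i, Nat.Prime ((f i).eval (n : ℤ)).natAbs),
          ∏ i, Real.log ((((f i).eval (n : ℤ)).natAbs : ℕ) : ℝ)) ~[atTop]
        fun x : ℕ => batemanHornConst f * (x : ℝ) := by
  obtain ⟨-, hCpos⟩ := IsBatemanHornSystem.hasBatemanHornConst_holds hf
  have hD : (0 : ℝ) < ∏ i, ((f i).natDegree : ℝ) :=
    prod_pos fun i _ => Nat.cast_pos.mpr (hf.natDegree_pos i)
  rw [batemanHornAsymptotic_iff_isEquivalent_card_system hf]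
  exact (isEquivalent_weightedSum_iff_card_pow
    (p := fun n : ℕ => ∀ i, Nat.Prime ((f i).eval (n : ℤ)).natAbs)
    (w := fun n : ℕ => ∏ i, Real.log ((((f i).eval (n : ℤ)).natAbs : ℕ) : ℝ))
    Fintype.card_ne_zero hD hCpos (fun n => prod_nonneg fun i _ => Real.log_natCast_nonneg _)
    (isEquivalent_prod_log_natAbs_eval hf.natDegree_pos)).symm

/-! ### The `Fin k` forms (the shape of the conjunct) -/

/-- `BatemanHornAsymptotic f ⟺ P_f(x) ~ (C(f)/∏ deg fᵢ) · x / log^k x` for `f : Fin k → ℤ[X]`. -/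
theorem batemanHornAsymptotic_iff_isEquivalent_card_fin {k : ℕ} {f : Fin k → ℤ[X]}
    (hf : IsBatemanHornSystem f) :
    BatemanHornAsymptotic f ↔
      (fun x : ℕ => (#((Icc 1 x).filter fun n : ℕ => ∀ i, Nat.Prime ((f i).eval (n : ℤ)).natAbs) : ℝ))
        ~[atTop] fun x : ℕ =>
          batemanHornConst f / (∏ i, ((f i).natDegree : ℝ)) * (x : ℝ) / Real.log x ^ k := by
  have h := batemanHornAsymptotic_iff_isEquivalent_card_system hf
  rw [Fintype.card_fin] at h
  convert h

/-- **`BatemanHornAsymptotic f ⟺ Θ_f(x) ~ C(f) x`** for `f : Fin k → ℤ[X]`, `k ≥ 1` — every instance of the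
conjunct `BatemanHorn` with at least one polynomial. -/
theorem batemanHornAsymptotic_iff_isEquivalent_theta_fin {k : ℕ} (hk : k ≠ 0) {f : Fin k → ℤ[X]}
    (hf : IsBatemanHornSystem f) :
    BatemanHornAsymptotic f ↔
      (fun x : ℕ => ∑ n ∈ (Icc 1 x).filter (fun n : ℕ => ∀ i, Nat.Prime ((f i).eval (n : ℤ)).natAbs),
          ∏ i, Real.log ((((f i).eval (n : ℤ)).natAbs : ℕ) : ℝ)) ~[atTop]
        fun x : ℕ => batemanHornConst f * (x : ℝ) := by
  haveI : Nonempty (Fin k) := ⟨⟨0, Nat.pos_of_ne_zero hk⟩⟩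
  convert batemanHornAsymptotic_iff_isEquivalent_theta_system hf

end Summit.Parity.BatemanHorn.Theorems
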